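import Summits.MatrixMultiplication.OmegaCensus.STPP222IcosetCriterionDual
import Summits.MatrixMultiplication.OmegaCensus.STPP222IcosetInvolutionForm

/-!
# ω-census, icoset class: the WITNESS CERTIFICATE INTERFACE (named criterion ↔ `IsSTPP ∧` involution-coset wording)

HONEST FRAMING (pub-omega census; verbatim): lottery ticket; floor = certified bounds/negative ranges.
Census STRUCTURE bookkeeping (Q7, the involution-coset class), nothing about `ω`.  Interface asked for by lead g32 (2026-08-27 18:52Z):
the criterion behind every class solver of the cell (ENG2 `icoset3`/`icwc`/`icrc`/`icsat`, `ICOSET-NOTE.md` / `ICR-NOTE.md`) and behind the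
kernel engines (`IcosetH`, `IcosetW`) as ONE NAMED PROPOSITION on icoset data, `Icoset.Data.WitnessForm` — (T) every frame `(sA_t, sB_t, sC_t)`
is `𝔽₂`-independent and (W) every non-constant index triple with vanishing `H`-word has a linear functional killing its six slots and equal to
`1` on its offset — with the equivalences a per-class UNSAT certificate (a DRAT proof of ENG2's `icsat` CNF, an `icwc` witness-node trace, or the
kernel search `IcosetW.vrefute`) has to be checked against: `isSTPP_iff_witnessForm` (proper data), `exists_isIcosetFamily_isSTPP_iff_witnessForm`
(class form, `pair` wording) and `exists_involutionCoset_isSTPP_iff_witnessForm` (census wording «every set a coset of an order-2 subgroup»,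
`H` without 2-torsion).  No cell is decided here; the content is gen 19's `Icoset.Data.isSTPP_iff_witness`.
References: H. Cohn, R. Kleinberg, B. Szegedy, C. Umans, FOCS 2005 (arXiv:math/0511460), Def. 5.1.  Seat pub-omega-kernel-l4 (gen 20), 2026-08-27.
-/

namespace Summit.MatrixMultiplication.OmegaCensus

open Literature.Computability.AlgebraicComplexity Finset

namespace Icoset

namespace Data

variable {V H : Type*} [AddCommGroup V] [Module (ZMod 2) V] [AddCommGroup H] {K : ℕ}

/-- **The witness certificate form** of the icoset criterion for data `d`: (T) every frame is `𝔽₂`-independent, and (W) every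
non-constant index triple `(i, j, k)` with `h(i,j,k) = 0` has a functional `φ ∈ V*` with `φ(slot_r) = 0` (`r < 6`) and `φ(off) = 1`.
A class NONE certificate for an `H`-class is exactly a refutation of `∃ (frames, offsets), WitnessForm` for that class's zero set.
[cite: CohnKleinbergSzegedyUmans2005, Def. 5.1] -/
def WitnessForm (d : Data V H K) : Prop :=
  (∀ t, d.Indep t) ∧ ∀ i j k : Fin K, ¬ (i = j ∧ j = k) → d.h i j k = 0 →
    ∃ φ : Module.Dual (ZMod 2) V, (∀ r, φ (d.slots i j k r) = 0) ∧ φ (d.off i j k) = 1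

variable [DecidableEq V] [DecidableEq H]

/-- Proper icoset data is STPP iff it satisfies the witness certificate form. [cite: CohnKleinbergSzegedyUmans2005, Def. 5.1] -/
theorem isSTPP_iff_witnessForm (d : Data V H K) (hd : d.Proper) : IsSTPP d.A d.B d.C ↔ d.WitnessForm := d.isSTPP_iff_witness hd

/-- The sets of proper data are cosets of order-2 subgroups (census wording). [folklore] -/
theorem isInvolutionCosetFamily (d : Data V H K) (hd : d.Proper) : IsInvolutionCosetFamily d.A d.B d.C := by
  have key : ∀ (x s : V) (a : H), s ≠ 0 → ∃ g w : V × H, w ≠ 0 ∧ w + w = 0 ∧ pair x s a = {g, g + w} := by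
    intro x s a hs
    refine ⟨(x, a), (s, 0), fun h => hs (by simpa using congrArg Prod.fst h), ?_, ?_⟩
    · rw [Prod.mk_add_mk, add_self_eq_zero, add_zero]; rfl
    · simp [pair]
  intro t
  exact ⟨key _ _ _ (hd t).1, key _ _ _ (hd t).2.1, key _ _ _ (hd t).2.2⟩

end Data

variable {V H : Type*} [AddCommGroup V] [Module (ZMod 2) V] [AddCommGroup H] [DecidableEq V] [DecidableEq H]

/-- **Class form.**  An icoset `(2,2,2)^K` STPP family (`pair` wording) exists iff some proper data satisfies the witness certificate
form. [cite: CohnKleinbergSzegedyUmans2005, Def. 5.1] -/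
theorem exists_isIcosetFamily_isSTPP_iff_witnessForm (K : ℕ) :
    (∃ A B C : Fin K → Finset (V × H), IsIcosetFamily A B C ∧ IsSTPP A B C) ↔ ∃ d : Data V H K, d.Proper ∧ d.WitnessForm := by
  rw [exists_isIcosetFamily_isSTPP_iff]
  refine exists_congr fun d => and_congr_right fun hd => ?_
  rw [← d.isSTPP_iff_witnessForm hd, d.isSTPP_iff hd]

/-- **Census wording.**  When `H` has no 2-torsion, a `(2,2,2)^K` STPP family all of whose sets are cosets of order-2 subgroups exists
iff some proper data satisfies the witness certificate form. [cite: CohnKleinbergSzegedyUmans2005, Def. 5.1] -/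
theorem exists_involutionCoset_isSTPP_iff_witnessForm (hH : ∀ h : H, h + h = 0 → h = 0) (K : ℕ) :
    (∃ A B C : Fin K → Finset (V × H), IsInvolutionCosetFamily A B C ∧ IsSTPP A B C) ↔ ∃ d : Data V H K, d.Proper ∧ d.WitnessForm := by
  rw [← exists_isIcosetFamily_isSTPP_iff_witnessForm]
  constructor
  · rintro ⟨A, B, C, hF, hS⟩; exact ⟨A, B, C, isIcosetFamily_of_involution_cosets hH hF, hS⟩
  · rintro ⟨A, B, C, hF, hS⟩
    obtain ⟨d, hd, rfl, rfl, rfl⟩ := exists_data_of_isIcosetFamily hF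
    exact ⟨d.A, d.B, d.C, d.isInvolutionCosetFamily hd, hS⟩

end Icoset

end Summit.MatrixMultiplication.OmegaCensus
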